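import Mathlib

/-!
# SoloBlind — a non-zero vector generates the standard module over a matrix algebra

Solo-blind residency on `HodgeConjecture` (session 26).  This file kernel-checks the one
finite-dimensional-algebra step of "Proposition K" of the residency's companion note
(`paper/k3-weil-faces.md` §3.10(b), §3.11): *if `M` is a module over the matrix algebra
`Matrix n n K` over a field `K` (compatibly with its `K`-vector-space structure) and
`finrank K M = card n`, then every non-zero vector `φ₀` generates `M`:
`∀ φ, ∃ r : Matrix n n K, r • φ₀ = φ`.*

In Proposition K it is applied with `K = ℚ`, `n = Fin 4` and
`M = Hom_Hdg(T, H¹(A₊) ⊗ H¹(A₋))` (a 4-dimensional `ℚ`-vector space), on which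
`End⁰(A₊) ⊗ End⁰(A₋)ᵒᵖ ≅ 𝕳 ⊗ 𝕳ᵒᵖ ≅ M₄(ℚ)` acts through algebraic correspondences: one non-zero
algebraic class `φ₀` then makes every class `r • φ₀` algebraic.  (For the `T₀`-family the same
statement is used with `K = ℚ(i)`, `n = Fin 4`, `finrank = 4` over `ℚ(i)`.)

The proof is elementary (matrix units): if `E a b • φ₀ ≠ 0` then the vectors
`E j a • (E a b • φ₀) = E j b • φ₀`, `j : n`, are `K`-linearly independent (apply `E a k`),
hence a basis by the dimension hypothesis, and a `K`-combination of them is `r • φ₀` for the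
matrix `r = ∑ j, c j • E j b`.

No project imports; standard axioms only.
-/

namespace Summit.HodgeConjecture.HodgeConjecture.Theorems
namespace SoloBlindTransitivity

open Matrix Module Submodule

variable {K : Type*} [Field K] {n : Type*} [Fintype n] [DecidableEq n]
variable {M : Type*} [AddCommGroup M] [Module K M] [Module (Matrix n n K) M]
  [IsScalarTower K (Matrix n n K) M]

/-- Matrix scalars commute with field scalars on `M` (from the tower hypothesis). -/
theorem smul_comm_single (c : K) (r : Matrix n n K) (x : M) : r • (c • x) = c • (r • x) := by
  have h1 : c • x = (c • (1 : Matrix n n K)) • x := by rw [smul_assoc, one_smul]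
  rw [h1, ← mul_smul, mul_smul_comm, mul_one, smul_assoc]

/-- If `E i i • ψ ≠ 0` then the vectors `E j i • ψ`, `j : n`, are linearly independent. -/
theorem linearIndependent_single_smul (ψ : M) (i : n) (hi : (single i i (1 : K)) • ψ ≠ 0) :
    LinearIndependent K (fun j : n => (single j i (1 : K)) • ψ) := by
  rw [Fintype.linearIndependent_iff]
  intro c hc k
  -- apply the matrix unit `E i k` to the relation `∑ j, c j • E j i • ψ = 0`
  have h := congrArg (fun v : M => (single i k (1 : K)) • v) hc
  simp only [Finset.smul_sum, smul_zero, smul_comm_single, ← mul_smul] at h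
  have hterm : ∀ j : n, c j • ((single i k (1 : K) * single j i (1 : K)) • ψ)
      = if j = k then c k • ((single i i (1 : K)) • ψ) else 0 := by
    intro j
    by_cases hjk : j = k
    · subst hjk
      simp [single_mul_single_same]
    · have hkj : k ≠ j := fun h => hjk h.symm
      rw [single_mul_single_of_ne (c := (1 : K)) i k j hkj 1, zero_smul, smul_zero, if_neg hjk]
  simp only [hterm, Finset.sum_ite_eq', Finset.mem_univ, if_true] at h
  by_contra hck
  exact hi ((smul_eq_zero.mp h).resolve_left hck)

/-- **Transitivity / cyclicity.**  Over the matrix algebra `Matrix n n K`, a module of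
`K`-dimension `card n` is generated by any non-zero vector. -/
theorem exists_smul_eq (hdim : finrank K M = Fintype.card n) {φ₀ : M} (h0 : φ₀ ≠ 0) (φ : M) :
    ∃ r : Matrix n n K, r • φ₀ = φ := by
  classical
  -- Step 1: some matrix unit does not kill `φ₀` (because `1 = ∑ E a b (1 a b)` does not).
  have hex : ∃ a b : n, (single a b (1 : K)) • φ₀ ≠ 0 := by
    by_contra hall
    push Not at hall
    apply h0
    have hone : (1 : Matrix n n K) • φ₀ = 0 := by
      rw [matrix_eq_sum_single (1 : Matrix n n K), Finset.sum_smul]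
      refine Finset.sum_eq_zero fun a _ => ?_
      rw [Finset.sum_smul]
      refine Finset.sum_eq_zero fun b _ => ?_
      have : single a b ((1 : Matrix n n K) a b) = ((1 : Matrix n n K) a b) • single a b (1 : K) := by
        rw [smul_single, smul_eq_mul, mul_one]
      rw [this, smul_assoc, hall a b, smul_zero]
    simpa using hone
  obtain ⟨a, b, hab⟩ := hex
  -- Step 2: `ψ := E a b • φ₀` satisfies `E a a • ψ = ψ ≠ 0`.
  set ψ : M := (single a b (1 : K)) • φ₀ with hψ
  have haa : (single a a (1 : K)) • ψ = ψ := by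
    rw [hψ, ← mul_smul, single_mul_single_same, mul_one]
  have hli := linearIndependent_single_smul (K := K) ψ a (by rw [haa]; exact hab)
  -- Step 3: `card n` independent vectors span `M`.
  haveI : Nonempty n := ⟨a⟩
  have hspan := hli.span_eq_top_of_card_eq_finrank hdim.symm
  have hφ : φ ∈ span K (Set.range fun j : n => (single j a (1 : K)) • ψ) := by
    rw [hspan]; exact mem_top
  obtain ⟨c, hc⟩ := mem_span_range_iff_exists_fun K |>.mp hφ
  -- Step 4: the combination is `r • φ₀` with `r = ∑ j, c j • (E j a * E a b)`.
  refine ⟨∑ j : n, c j • (single j a (1 : K) * single a b (1 : K)), ?_⟩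
  rw [Finset.sum_smul]
  rw [← hc]
  refine Finset.sum_congr rfl fun j _ => ?_
  rw [smul_assoc, mul_smul]

/-- The form used in Proposition K: with `K = ℚ`, `n = Fin 4`, a `ℚ`-vector space of dimension
`4` carrying a compatible `M₄(ℚ)`-module structure is generated by any non-zero vector. -/
theorem exists_smul_eq_rat4 {M : Type*} [AddCommGroup M] [Module ℚ M]
    [Module (Matrix (Fin 4) (Fin 4) ℚ) M] [IsScalarTower ℚ (Matrix (Fin 4) (Fin 4) ℚ) M]
    (hdim : finrank ℚ M = 4) {φ₀ : M} (h0 : φ₀ ≠ 0) (φ : M) :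
    ∃ r : Matrix (Fin 4) (Fin 4) ℚ, r • φ₀ = φ :=
  exists_smul_eq (K := ℚ) (n := Fin 4) (by simpa using hdim) h0 φ

/-- Consequently such a module is simple in the weak sense needed: every non-zero
`Matrix n n K`-stable `K`-subspace containing a non-zero vector is everything. -/
theorem eq_top_of_smul_mem (hdim : finrank K M = Fintype.card n) (N : Submodule K M)
    (hN : ∀ (r : Matrix n n K) (x : M), x ∈ N → r • x ∈ N) {φ₀ : M} (h0 : φ₀ ≠ 0)
    (hmem : φ₀ ∈ N) : N = ⊤ := by
  refine eq_top_iff.mpr fun φ _ => ?_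
  obtain ⟨r, hr⟩ := exists_smul_eq (K := K) hdim h0 φ
  rw [← hr]
  exact hN r φ₀ hmem

end SoloBlindTransitivity
end Summit.HodgeConjecture.HodgeConjecture.Theorems
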